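import Mathlib.Analysis.SpecialFunctions.Log.Basic
import Mathlib.MeasureTheory.Integral.DominatedConvergence
import Literature.Geometry.Riemannian.ShrinkerEntropyProofs

/-!
# Stub `stub_modelValueSplitLine` (U2) of line `collapsed-ends-usc`, crux
# `EntropyRung.NoncompactShrinkerGap` (stmt-SmoothPoincare4-10868) — part 1: the cut-off profile

Helper file (`--supports`) for the proof of the registered stub `stub_modelValueSplitLine`: on the
split limit `N³ × ℝ` of a collapsed end, the cut-offs `W_K(y,t) = F_K(φ(y)) F_K(t²/4)` of the
Gaussian profile `e^{-(φ + t²/4)/2}`, `F_K(s) = ρ(s/K) e^{-s/2}`, bring Perelman's functional within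
`ε` of `log((4π)⁻² · 2√π ∫_N e^{-φ})`. This file is the real-variable layer shared by the `N`-factor
(`s = φ`, a normalised 3-d shrinker potential) and the `ℝ`-factor (`s = t²/4`, the normalised
1-d Gaussian shrinker potential, `|∇(t²/4)|² = t²/4`):
* `tendsto_integral_bdd_mul` — dominated convergence for a bounded modulation `E_k G` of a fixed
  integrable `G` with `E_k → e` pointwise;
* `exists_profile` — a smooth cut-off profile `ρ` (`= 1` on `(-∞,1]`, `= 0` on `[2,∞)`, `0 ≤ ρ ≤ 1`,
  `ρ' = 0` on `(-∞,1)`, `|ρ'| ≤ C`), from `CarrilloNi2009_shrinkerLSI.exists_cutoffProfile`;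
* the algebra of `F_K`: its derivative `F_K' = (ρ'(s/K)/K − ρ(s/K)/2) e^{-s/2}`, `F_K² = ρ² e^{-s}`,
  `F_K'(s)² q = (ρ'/K − ρ/2)² (q e^{-s})`, `F_K² log F_K² = (ρ² log ρ²) e^{-s} − ρ² (s e^{-s})`;
* the three limits `∫ ρ(ψ/(k+1))² G → ∫ G`, `∫ (ρ'/(k+1) − ρ/2)² G → ¼ ∫ G`,
  `∫ (ρ² log ρ²)(ψ/(k+1)) G → 0` over any measure space, for measurable `ψ` and integrable `G`.
No new definitions; everything is proved.
-/

noncomputable section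

-- `Summit.SmoothPoincare4.SmoothPoincare4.…` (summit = problem) trips `dupNamespace` on every decl.
set_option linter.dupNamespace false

namespace Summit.SmoothPoincare4.SmoothPoincare4.Theorems.NoncompactShrinkerGapModelValueSplitLine

open MeasureTheory Filter Set
open scoped Topology ContDiff

/-! ### Dominated convergence for a bounded modulation -/

/-- **Dominated convergence for a bounded modulation of an integrable function**: if `|E_k| ≤ M`,
`E_k → e` pointwise and `G` is integrable then `∫ E_k G → e ∫ G`. [folklore] -/
theorem tendsto_integral_bdd_mul {X : Type*} [MeasurableSpace X] {μ : Measure X}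
    {E : ℕ → X → ℝ} {G : X → ℝ} {e M : ℝ} (hE : ∀ k, AEStronglyMeasurable (E k) μ)
    (hG : Integrable G μ) (hM : ∀ k x, |E k x| ≤ M)
    (hlim : ∀ x, Tendsto (fun k ↦ E k x) atTop (𝓝 e)) :
    Tendsto (fun k ↦ ∫ x, E k x * G x ∂μ) atTop (𝓝 (e * ∫ x, G x ∂μ)) := by
  rw [← integral_const_mul]
  refine tendsto_integral_of_dominated_convergence (fun x ↦ M * ‖G x‖)
    (fun k ↦ (hE k).mul hG.aestronglyMeasurable) (hG.norm.const_mul M)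
    (fun k ↦ Eventually.of_forall fun x ↦ ?_)
    (Eventually.of_forall fun x ↦ (hlim x).mul_const _)
  rw [norm_mul, Real.norm_eq_abs]
  exact mul_le_mul_of_nonneg_right (hM k x) (norm_nonneg _)

/-- A bounded measurable modulation of an integrable function is integrable. [folklore] -/
theorem integrable_bdd_mul {X : Type*} [MeasurableSpace X] {μ : Measure X}
    {E G : X → ℝ} {M : ℝ} (hE : AEStronglyMeasurable E μ) (hG : Integrable G μ)
    (hM : ∀ x, |E x| ≤ M) : Integrable (fun x ↦ E x * G x) μ :=
  hG.bdd_mul hE (Eventually.of_forall fun x ↦ by simpa [Real.norm_eq_abs] using hM x)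

/-! ### `x log x` on `[0, 1]` -/

/-- `|x log x| ≤ 1` for `0 ≤ x ≤ 1`. [folklore] -/
theorem abs_mul_log_le_one {x : ℝ} (h0 : 0 ≤ x) (h1 : x ≤ 1) : |x * Real.log x| ≤ 1 := by
  rcases h0.eq_or_lt with rfl | hpos
  · simp
  · rw [mul_comm]
    exact (Real.abs_log_mul_self_lt x hpos h1).le

/-! ### The cut-off profile -/

/-- **A smooth cut-off profile**: `ρ ∈ C^∞(ℝ)`, `ρ = 1` on `(-∞, 1]`, `ρ = 0` on `[2, ∞)`,
`0 ≤ ρ ≤ 1`, `ρ' = 0` on `(-∞, 1)` and `|ρ'| ≤ C` (the profile `1 − smoothTransition (· − 1)` of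
`CarrilloNi2009_shrinkerLSI.exists_cutoffProfile`). [folklore] -/
theorem exists_profile : ∃ ρ : ℝ → ℝ, ContDiff ℝ ∞ ρ ∧ (∀ t ≤ 1, ρ t = 1) ∧
    (∀ t, 2 ≤ t → ρ t = 0) ∧ (∀ t, 0 ≤ ρ t ∧ ρ t ≤ 1) ∧ (∀ t < 1, deriv ρ t = 0) ∧
    ∃ C : ℝ, 0 ≤ C ∧ ∀ t, |deriv ρ t| ≤ C := by
  obtain ⟨ρ, hs, h1, h0, h01, C, hC⟩ :=
    Literature.Geometry.Riemannian.CarrilloNi2009_shrinkerLSI.exists_cutoffProfile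
  refine ⟨ρ, hs, h1, h0, h01, fun t ht ↦ ?_, C, (abs_nonneg _).trans (hC 0), hC⟩
  have hev : ρ =ᶠ[𝓝 t] fun _ ↦ (1 : ℝ) := by
    filter_upwards [Iio_mem_nhds ht] with s hs using h1 s (le_of_lt hs)
  rw [hev.deriv_eq, deriv_const]

section Profile

variable {ρ : ℝ → ℝ} {C : ℝ}

/-- The scaled cut-off `ρ(s/(k+1))` is eventually `1` at every `s`. [folklore] -/
theorem eventually_profile_div_eq_one (h1 : ∀ t ≤ 1, ρ t = 1) (s : ℝ) :
    ∀ᶠ k : ℕ in atTop, ρ (s / ((k : ℝ) + 1)) = 1 := by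
  obtain ⟨N, hN⟩ := exists_nat_ge s
  filter_upwards [eventually_ge_atTop N] with k hk
  refine h1 _ ?_
  rw [div_le_one (by positivity)]
  calc s ≤ N := hN
    _ ≤ k := by exact_mod_cast hk
    _ ≤ k + 1 := by linarith

/-- The derivative factor `ρ'(s/(k+1))` is eventually `0` at every `s`. [folklore] -/
theorem eventually_deriv_profile_div_eq_zero (hd : ∀ t < 1, deriv ρ t = 0) (s : ℝ) :
    ∀ᶠ k : ℕ in atTop, deriv ρ (s / ((k : ℝ) + 1)) = 0 := by
  obtain ⟨N, hN⟩ := exists_nat_gt s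
  filter_upwards [eventually_ge_atTop N] with k hk
  refine hd _ ?_
  rw [div_lt_one (by positivity)]
  calc s < N := hN
    _ ≤ k := by exact_mod_cast hk
    _ < k + 1 := by linarith

/-- **The cut Gaussian profile and its derivative**: for `F_K(s) = ρ(s/K) e^{-s/2}`,
`F_K'(s) = (ρ'(s/K)/K − ρ(s/K)/2) e^{-s/2}`. [folklore] -/
theorem hasDerivAt_profileF (hs : ContDiff ℝ ∞ ρ) (K s : ℝ) :
    HasDerivAt (fun s ↦ ρ (s / K) * Real.exp (-s / 2))
      ((deriv ρ (s / K) / K - ρ (s / K) / 2) * Real.exp (-s / 2)) s := by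
  have h1 : HasDerivAt (fun s : ℝ ↦ s / K) (1 / K) s := (hasDerivAt_id s).div_const K
  have h2 : HasDerivAt ρ (deriv ρ (s / K)) (s / K) :=
    (hs.differentiable (by norm_num) _).hasDerivAt
  have h3 : HasDerivAt (fun s ↦ ρ (s / K)) (deriv ρ (s / K) * (1 / K)) s := h2.comp s h1
  have h4 : HasDerivAt (fun s : ℝ ↦ Real.exp (-s / 2)) (Real.exp (-s / 2) * (-1 / 2)) s := by
    have h5 : HasDerivAt (fun s : ℝ ↦ -s / 2) (-1 / 2) s := by
      simpa using ((hasDerivAt_id s).neg).div_const 2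
    exact h5.exp
  refine (h3.fun_mul h4).congr_deriv ?_
  ring

/-- `F_K` is smooth. [folklore] -/
theorem contDiff_profileF (hs : ContDiff ℝ ∞ ρ) (K : ℝ) :
    ContDiff ℝ ∞ (fun s ↦ ρ (s / K) * Real.exp (-s / 2)) :=
  (hs.comp (contDiff_id.div_const K)).mul (Real.contDiff_exp.comp (contDiff_neg.div_const 2))

/-- `F_K(s) = 0` for `s ≥ 2K` (`K > 0`). [folklore] -/
theorem profileF_eq_zero (h0 : ∀ t, 2 ≤ t → ρ t = 0) {K : ℝ} (hK : 0 < K) {s : ℝ}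
    (hs : 2 * K ≤ s) : ρ (s / K) * Real.exp (-s / 2) = 0 := by
  rw [h0 _ (by rwa [le_div_iff₀ hK]), zero_mul]

/-- `F_K(s)² = ρ(s/K)² e^{-s}`. [folklore] -/
theorem profileF_sq (K s : ℝ) :
    (ρ (s / K) * Real.exp (-s / 2)) ^ 2 = ρ (s / K) ^ 2 * Real.exp (-s) := by
  rw [mul_pow, ← Real.exp_nat_mul]
  congr 2
  ring

/-- `F_K'(s)² q = (ρ'(s/K)/K − ρ(s/K)/2)² (q e^{-s})` — the gradient term `|∇(F_K ∘ ψ)|² =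
F_K'(ψ)² |∇ψ|²`. [folklore] -/
theorem profileF_deriv_sq_mul (K s q : ℝ) :
    ((deriv ρ (s / K) / K - ρ (s / K) / 2) * Real.exp (-s / 2)) ^ 2 * q =
      (deriv ρ (s / K) / K - ρ (s / K) / 2) ^ 2 * (q * Real.exp (-s)) := by
  rw [mul_pow, ← Real.exp_nat_mul]
  have : ((2 : ℕ) : ℝ) * (-s / 2) = -s := by ring
  rw [this]
  ring

/-- `F_K² log F_K² = (ρ² log ρ²) e^{-s} − ρ² (s e^{-s})` (also when `ρ = 0`, both sides vanishing).
[folklore] -/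
theorem profileF_sq_mul_log (K s : ℝ) :
    (ρ (s / K) * Real.exp (-s / 2)) ^ 2 * Real.log ((ρ (s / K) * Real.exp (-s / 2)) ^ 2) =
      ρ (s / K) ^ 2 * Real.log (ρ (s / K) ^ 2) * Real.exp (-s) -
        ρ (s / K) ^ 2 * (s * Real.exp (-s)) := by
  rw [profileF_sq]
  by_cases hρ : ρ (s / K) = 0
  · simp [hρ]
  · rw [Real.log_mul (pow_ne_zero 2 hρ) (Real.exp_pos _).ne', Real.log_exp]
    ring

/-- `|ρ(s)²| ≤ 1`. [folklore] -/
theorem abs_profile_sq_le (h01 : ∀ t, 0 ≤ ρ t ∧ ρ t ≤ 1) (s : ℝ) : |ρ s ^ 2| ≤ 1 := by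
  rw [abs_of_nonneg (sq_nonneg _), sq_le_one_iff₀ (h01 s).1]
  exact (h01 s).2

/-- `|(ρ'(s)/K − ρ(s)/2)²| ≤ (C + 1)²` for `K ≥ 1`, `|ρ'| ≤ C`. [folklore] -/
theorem abs_profile_deriv_sq_le (h01 : ∀ t, 0 ≤ ρ t ∧ ρ t ≤ 1) (hC0 : 0 ≤ C)
    (hC : ∀ t, |deriv ρ t| ≤ C) {K : ℝ} (hK : 1 ≤ K) (s : ℝ) :
    |(deriv ρ s / K - ρ s / 2) ^ 2| ≤ (C + 1) ^ 2 := by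
  rw [abs_of_nonneg (sq_nonneg _)]
  have h1 : |deriv ρ s / K - ρ s / 2| ≤ C + 1 := by
    have hK0 : 0 < K := by linarith
    have h2 : |deriv ρ s / K| ≤ C := by
      rw [abs_div, abs_of_pos hK0, div_le_iff₀ hK0]
      nlinarith [hC s, abs_nonneg (deriv ρ s)]
    have h3 : |ρ s / 2| ≤ 1 := by
      rw [abs_of_nonneg (by linarith [(h01 s).1])]
      linarith [(h01 s).2]
    calc |deriv ρ s / K - ρ s / 2| ≤ |deriv ρ s / K| + |ρ s / 2| := abs_sub _ _
      _ ≤ C + 1 := add_le_add h2 h3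
  calc (deriv ρ s / K - ρ s / 2) ^ 2 = |deriv ρ s / K - ρ s / 2| ^ 2 := (sq_abs _).symm
    _ ≤ (C + 1) ^ 2 := pow_le_pow_left₀ (abs_nonneg _) h1 2

/-- `|ρ² log ρ²| ≤ 1`. [folklore] -/
theorem abs_profile_sq_mul_log_le (h01 : ∀ t, 0 ≤ ρ t ∧ ρ t ≤ 1) (s : ℝ) :
    |ρ s ^ 2 * Real.log (ρ s ^ 2)| ≤ 1 :=
  abs_mul_log_le_one (sq_nonneg _) ((sq_le_one_iff₀ (h01 s).1).2 (h01 s).2)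

/-! ### The three limits -/

variable {X : Type*} [MeasurableSpace X] {μ : Measure X} {ψ G : X → ℝ}

/-- `∫ ρ(ψ/(k+1))² G → ∫ G`. [folklore] -/
theorem tendsto_integral_profile_sq_mul (hs : ContDiff ℝ ∞ ρ) (h1 : ∀ t ≤ 1, ρ t = 1)
    (h01 : ∀ t, 0 ≤ ρ t ∧ ρ t ≤ 1) (hψ : AEStronglyMeasurable ψ μ) (hG : Integrable G μ) :
    Tendsto (fun k : ℕ ↦ ∫ x, ρ (ψ x / (k + 1)) ^ 2 * G x ∂μ) atTop (𝓝 (∫ x, G x ∂μ)) := by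
  have h := tendsto_integral_bdd_mul (E := fun (k : ℕ) x ↦ ρ (ψ x / (k + 1)) ^ 2) (e := 1) (M := 1)
    (fun k ↦ ((hs.continuous.comp (continuous_id.div_const _)).pow 2).comp_aestronglyMeasurable hψ)
    hG (fun k x ↦ abs_profile_sq_le h01 _) (fun x ↦ ?_)
  · simpa using h
  · refine tendsto_const_nhds.congr' ?_
    filter_upwards [eventually_profile_div_eq_one h1 (ψ x)] with k hk
    simp [hk]

/-- `∫ ρ(ψ/(k+1))² G` is integrable term. [folklore] -/
theorem integrable_profile_sq_mul (hs : ContDiff ℝ ∞ ρ) (h01 : ∀ t, 0 ≤ ρ t ∧ ρ t ≤ 1)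
    (hψ : AEStronglyMeasurable ψ μ) (hG : Integrable G μ) (K : ℝ) :
    Integrable (fun x ↦ ρ (ψ x / K) ^ 2 * G x) μ :=
  integrable_bdd_mul
    (((hs.continuous.comp (continuous_id.div_const _)).pow 2).comp_aestronglyMeasurable hψ) hG
    (fun _ ↦ abs_profile_sq_le h01 _)

/-- `∫ (ρ'(ψ/(k+1))/(k+1) − ρ(ψ/(k+1))/2)² G → ¼ ∫ G`. [folklore] -/
theorem tendsto_integral_profile_deriv_sq_mul (hs : ContDiff ℝ ∞ ρ) (h1 : ∀ t ≤ 1, ρ t = 1)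
    (h01 : ∀ t, 0 ≤ ρ t ∧ ρ t ≤ 1) (hd : ∀ t < 1, deriv ρ t = 0) (hC0 : 0 ≤ C)
    (hC : ∀ t, |deriv ρ t| ≤ C) (hψ : AEStronglyMeasurable ψ μ) (hG : Integrable G μ) :
    Tendsto
      (fun k : ℕ ↦ ∫ x, (deriv ρ (ψ x / (k + 1)) / (k + 1) - ρ (ψ x / (k + 1)) / 2) ^ 2 * G x ∂μ)
      atTop (𝓝 (1 / 4 * ∫ x, G x ∂μ)) := by
  refine tendsto_integral_bdd_mul
    (E := fun (k : ℕ) x ↦ (deriv ρ (ψ x / (k + 1)) / (k + 1) - ρ (ψ x / (k + 1)) / 2) ^ 2)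
    (M := (C + 1) ^ 2) (fun k ↦ ?_) hG (fun k x ↦ ?_) (fun x ↦ ?_)
  · have hc : Continuous fun s : ℝ ↦ (deriv ρ (s / (k + 1)) / (k + 1) - ρ (s / (k + 1)) / 2) ^ 2 :=
      ((((hs.continuous_deriv ENat.LEInfty.out).comp (continuous_id.div_const _)).div_const _).sub
        ((hs.continuous.comp (continuous_id.div_const _)).div_const _)).pow 2
    exact hc.comp_aestronglyMeasurable hψ
  · exact abs_profile_deriv_sq_le h01 hC0 hC (by simp) _
  · refine tendsto_const_nhds.congr' ?_
    filter_upwards [eventually_profile_div_eq_one h1 (ψ x),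
      eventually_deriv_profile_div_eq_zero hd (ψ x)] with k hk hk'
    rw [hk, hk']
    norm_num

/-- The gradient term is integrable. [folklore] -/
theorem integrable_profile_deriv_sq_mul (hs : ContDiff ℝ ∞ ρ) (h01 : ∀ t, 0 ≤ ρ t ∧ ρ t ≤ 1)
    (hC0 : 0 ≤ C) (hC : ∀ t, |deriv ρ t| ≤ C) (hψ : AEStronglyMeasurable ψ μ)
    (hG : Integrable G μ) {K : ℝ} (hK : 1 ≤ K) :
    Integrable (fun x ↦ (deriv ρ (ψ x / K) / K - ρ (ψ x / K) / 2) ^ 2 * G x) μ := by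
  refine integrable_bdd_mul ?_ hG (fun x ↦ abs_profile_deriv_sq_le h01 hC0 hC hK _)
  have hc : Continuous fun s : ℝ ↦ (deriv ρ (s / K) / K - ρ (s / K) / 2) ^ 2 :=
    ((((hs.continuous_deriv ENat.LEInfty.out).comp (continuous_id.div_const _)).div_const _).sub
      ((hs.continuous.comp (continuous_id.div_const _)).div_const _)).pow 2
  exact hc.comp_aestronglyMeasurable hψ

/-- `∫ (ρ² log ρ²)(ψ/(k+1)) G → 0`. [folklore] -/
theorem tendsto_integral_profile_sq_log_mul (hs : ContDiff ℝ ∞ ρ) (h1 : ∀ t ≤ 1, ρ t = 1)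
    (h01 : ∀ t, 0 ≤ ρ t ∧ ρ t ≤ 1) (hψ : AEStronglyMeasurable ψ μ) (hG : Integrable G μ) :
    Tendsto (fun k : ℕ ↦ ∫ x, ρ (ψ x / (k + 1)) ^ 2 * Real.log (ρ (ψ x / (k + 1)) ^ 2) * G x ∂μ)
      atTop (𝓝 0) := by
  have h := tendsto_integral_bdd_mul
    (E := fun (k : ℕ) x ↦ ρ (ψ x / (k + 1)) ^ 2 * Real.log (ρ (ψ x / (k + 1)) ^ 2)) (e := 0)
    (M := 1)
    (fun k ↦ ?_) hG (fun k x ↦ abs_profile_sq_mul_log_le h01 _) (fun x ↦ ?_)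
  · simpa using h
  · have hm : Measurable fun s : ℝ ↦ ρ (s / (k + 1)) ^ 2 * Real.log (ρ (s / (k + 1)) ^ 2) := by
      have hc : Continuous fun s : ℝ ↦ ρ (s / (k + 1)) ^ 2 :=
        (hs.continuous.comp (continuous_id.div_const _)).pow 2
      exact hc.measurable.mul (Real.measurable_log.comp hc.measurable)
    exact hm.comp_aemeasurable hψ.aemeasurable |>.aestronglyMeasurable
  · refine tendsto_const_nhds.congr' ?_
    filter_upwards [eventually_profile_div_eq_one h1 (ψ x)] with k hk
    simp [hk]

/-- The entropy correction term is integrable. [folklore] -/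
theorem integrable_profile_sq_log_mul (hs : ContDiff ℝ ∞ ρ) (h01 : ∀ t, 0 ≤ ρ t ∧ ρ t ≤ 1)
    (hψ : AEStronglyMeasurable ψ μ) (hG : Integrable G μ) (K : ℝ) :
    Integrable (fun x ↦ ρ (ψ x / K) ^ 2 * Real.log (ρ (ψ x / K) ^ 2) * G x) μ := by
  refine integrable_bdd_mul ?_ hG (fun x ↦ abs_profile_sq_mul_log_le h01 _)
  have hm : Measurable fun s : ℝ ↦ ρ (s / K) ^ 2 * Real.log (ρ (s / K) ^ 2) := by
    have hc : Continuous fun s : ℝ ↦ ρ (s / K) ^ 2 :=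
      (hs.continuous.comp (continuous_id.div_const _)).pow 2
    exact hc.measurable.mul (Real.measurable_log.comp hc.measurable)
  exact hm.comp_aemeasurable hψ.aemeasurable |>.aestronglyMeasurable

end Profile

/-- **Registered sub-goal `stub_cutoffGradientLimit` of the crux** (the deciding statement of this
file): along the scaled cut-offs `ρ(ψ/(k+1))` of a profile `ρ` the gradient factor
`(ρ'(ψ/(k+1))/(k+1) − ρ(ψ/(k+1))/2)²` modulating an integrable `G` converges, `∫ (…)² G → ¼ ∫ G`
(the term `4|∇(F_K ∘ ψ)|² → |∇ψ|² e^{-ψ}` of the cut Gaussian profile). [folklore] -/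
theorem stub_cutoffGradientLimit : ∀ (ρ : ℝ → ℝ) (C : ℝ), ContDiff ℝ ∞ ρ → (∀ t ≤ 1, ρ t = 1) → (∀ t, 0 ≤ ρ t ∧ ρ t ≤ 1) → (∀ t < 1, deriv ρ t = 0) → 0 ≤ C → (∀ t, |deriv ρ t| ≤ C) → ∀ (X : Type) [MeasurableSpace X] (μ : MeasureTheory.Measure X) (ψ G : X → ℝ), MeasureTheory.AEStronglyMeasurable ψ μ → MeasureTheory.Integrable G μ → Filter.Tendsto (fun k : ℕ ↦ ∫ x, (deriv ρ (ψ x / (k + 1)) / (k + 1) - ρ (ψ x / (k + 1)) / 2) ^ 2 * G x ∂μ) Filter.atTop (nhds (1 / 4 * ∫ x, G x ∂μ)) :=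
  fun _ _ hs h1 h01 hd hC0 hC _ _ _ _ _ hψ hG ↦
    tendsto_integral_profile_deriv_sq_mul hs h1 h01 hd hC0 hC hψ hG

end Summit.SmoothPoincare4.SmoothPoincare4.Theorems.NoncompactShrinkerGapModelValueSplitLine

end
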